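import Summits.ResolutionOfSingularities.ResolutionOfSingularities.Theorems.FrobeniusClosingSteerWords16LowTowerA
import Summits.ResolutionOfSingularities.ResolutionOfSingularities.Theorems.FrobeniusClosingSteerLowTaming
import Summits.ResolutionOfSingularities.ResolutionOfSingularities.Theorems.FrobeniusClosingSteerLowTowerPointSteps
import Summits.ResolutionOfSingularities.ResolutionOfSingularities.Theorems.FrobeniusClosingSteerLowTowerSingular
import Summits.ResolutionOfSingularities.ResolutionOfSingularities.Theorems.FrobeniusClosingSteerThreadFinitelyHit
import Summits.ResolutionOfSingularities.ResolutionOfSingularities.Theorems.FrobeniusClosingSteerThreadWander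
import Summits.ResolutionOfSingularities.ResolutionOfSingularities.Theorems.FrobeniusClosingSteerTowerHeight

/-!
# Crux `Steer` (stmt-ResolutionOfSingularities-16345), line `switching-dichotomy` — WORDS 16B: §σ2.24 THE LOW TOWER INTERFACE (part 2) and the D3 GLUE — D3b′ `LowTowerPointStepsIOTwo`, D3c `LowTowerTamingTwo` (+ res-type-062's leaf), D3d `LowTowerSingularTwo`, the D3 compositions, T-i `finitelyHitThreadTwoN_holds` (res-D-pv-011), `threadWanderTwoN_of_debts`, the D3b′/D3d leaves (res-D-pv-007 / res-L0-w41-stub-3) (HOIST of the registered skeleton r41 3f52716f8cdb387f, l.1541–1816, inside `section SteeredTwo`)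

Holder res-L0-w41-lead-1 g5 on res-L0-w41-plan-1 RULING 47 (E1) / 104b; see `…Words01Core` for the hoist protocol (bodies byte for byte;
`[cite: …]` / `[folklore]` tags on CLOSED `def … : Prop` words are written «(ref. …)» / «(folklore)» — GATE NOTE of `…Words02Stubs`;
cite keys inside `[cite:]` tags normalised to `references.bib` keys where needed, as in `…Words03Phases`).
Nothing here is a statement of the manuscript [claim: Hironaka2017, status: under-review]. OURS (candidates / vocabulary; AI review is
weaker than expert review).
-/

open Summit.ResolutionOfSingularities.ResolutionOfSingularities.Theses.FrobeniusClosing (IsolatedForcedTermination)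
open Literature.AlgebraicGeometry.Resolution (IsAbhyankarPlace FGOver exists_ringKrullDim_eq_and_trdeg_eq
  trdeg_eq_trdeg_of_isFractionRing locAtCentre IsQuadraticTransformAlong SubringDominates IsRsopPart
  LocalUniformization3 RelLocalUniformization CossartPiltant2019General)
open Summit.ResolutionOfSingularities.ResolutionOfSingularities.Theorems.SteerRankThinness
  (HasProperCoarsening concl_of_hasProperCoarsening rankOne_of_not_hasProperCoarsening)
open Summit.ResolutionOfSingularities.ResolutionOfSingularities.Theorems.PfaffLine

set_option linter.dupNamespace false

namespace Summit.ResolutionOfSingularities.ResolutionOfSingularities.Theorems.SwitchingDichotomy.Words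

section SteeredTwo

open IsLocalRing
open Literature.AlgebraicGeometry.Resolution (IsLocalBlowupAlong IsQuadraticTransform IsExcellentRing)

variable {K : Type} [Field K]


/-- **D3b′ · LowTowerPointStepsIOTwo** (M, TOWER-LEVEL form of D3b; res-D-pv-007 AS stub-5, TREE: p516366 + p516773
`CurveStepCleaning.exists_sq_eq_of_eventual_curveChain_subring`): a LOW tower has infinitely many point stages — were all stages from `n₀` on
curve stages, (T7) fixes `A := A n₀`, (T5) gives the curve-chain law `h i − (g i)² = (x i)²·h (i+1)` with `x i ∈ 𝔪_A`, so `h n₀` is a square in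
`A` (pv-007), contradicting (T3). Leaf ingredients: (T1) regular ⇒ Noetherian + integrally closed, `Algebra k (A n)` from the subalgebra.
Why it might fail: instance plumbing only. OURS. (folklore) -/
def LowTowerPointStepsIOTwo : Prop :=
  ∀ (k L : Type) [Field k] [CharP k 2] [PerfectField k] [Field L] [Algebra k L]
    (A Y : ℕ → Subalgebra k L) (h T x g : ℕ → L) (pt : Set ℕ),
    IsLowTowerTwo k L A Y h T x g pt → pt.Infinite

/-- **D3c · LowTowerTamingTwo** (L; res-type-062: (T1)–(T4) of its D3c CUT 08:58:25Z — singular height-one primes of `h n` over `A n`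
(res-type-082's criterion `RadicandSingular.not_isRegularLocalRing_adjoinRoot_atPrime_iff` unfolds `IsSingPrime`), BAD := singular with
non-regular quotient; curve stages keep `A` and do not create bad curves, point stages transform every curve germ (QT one level down, (T6) chart
data) and never create bad curves (exceptional prime has regular quotient); `Sing₁(h n)` is finite once a derivation value `D(h n) ≠ 0` exists —
from (T3) + (T1) via res-D-pv-007 `NormalStart.exists_derivation_apply_ne_zero`; bad lineages die by p515973 `CurveLineage` (δ drops at each of
the infinitely many point stages) and the graded König / Σδ potential ⇒ from some `n₀` on NO bad curve; then at a POINT stage `n ≥ n₀` clause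
(T9) removes the good singular curves too ⇒ the singularity of `Y n` is isolated ⇒ `Y n` is NORMAL (res-type-026
`RadicandChainTwo.isIntegrallyClosed_of_isolated`, transported along the presentation (T2)+(T3), 026's `lift_injective_of_forall_pow_ne`) ⇒
`IsNormalIn (Y n)` ((T2): fraction field `L`). Why it might fail: a bad curve hit infinitely often by point stages whose δ does not drop because
the point is not ON the curve's singular branch — excluded: every point stage is centred at the closed point through which all curves pass.
OURS. (ref. Kollar2007, Lecture 1.101) (folklore) -/
def LowTowerTamingTwo : Prop :=
  ∀ (k L : Type) [Field k] [CharP k 2] [PerfectField k] [Field L] [Algebra k L]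
    (A Y : ℕ → Subalgebra k L) (h T x g : ℕ → L) (pt : Set ℕ),
    IsLowTowerTwo k L A Y h T x g pt → pt.Infinite →
      ∃ n₀, ∀ n, n₀ ≤ n → n ∈ pt → IsNormalIn (Y n).toSubring

/-- D3c holds (res-type-062 g14): `LowTaming.lowTowerTaming`, tree file `FrobeniusClosingSteerLowTaming.lean`. -/
theorem lowTowerTamingTwo_holds : LowTowerTamingTwo := by
  intro k L _ _ _ _ _ A Y h T x g pt htower hio
  obtain ⟨hch, hAl, -, hT1, hT2, hT3, -, hT5, hT6, hT7, hT9⟩ := htower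
  haveI := hch
  exact _root_.Summit.ResolutionOfSingularities.ResolutionOfSingularities.Theorems.SwitchingDichotomy.LowTaming.lowTowerTaming
    A Y h T x g pt hAl hT1 hT2 hT3 hT5 hT6 (fun n hn => (hT7 n hn).1) hT9 hio


/-- **D3d · LowTowerSingularTwo** (S–M; res-L0-w41-stub-3, TREE: p516250 `LowStageSingular.not_isRegularLocalRing_of_ringEquiv_adjoinRoot` +
`exists_sub_pow_mem_sq_map`): every member of a LOW tower is SINGULAR — (T4) gives `h n − γ² ∈ 𝔪²_{A n}`, (T1) `A n` regular local of
characteristic 2, and (T2)+(T3) present `Y n ≃+* AdjoinRoot (X² − C (h n))` over `A n` (pv-012 `closure_insert_eq_lift_range` + 026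
`lift_injective_of_forall_pow_ne`). Why it might fail: the `≃+*` direction/universe bookkeeping only. OURS. (ref. Matsumura1987, Thm. 14.2) -/
def LowTowerSingularTwo : Prop :=
  ∀ (k L : Type) [Field k] [CharP k 2] [PerfectField k] [Field L] [Algebra k L]
    (A Y : ℕ → Subalgebra k L) (h T x g : ℕ → L) (pt : Set ℕ),
    IsLowTowerTwo k L A Y h T x g pt → ∀ n, ¬ IsRegularLocalRing (Y n)

/-- **§σ2.24 THE D3 GLUE** (PROVED; res-L0-w41-strat-2): D3 `LowRunTamedMixedBranchTwo` from the LOW inputs (duals, B7, C8) and the four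
tower-level pieces D3a / D3b′ / D3c / D3d. Pure logic over `IsLowTowerTwo`: clause (1) of `IsTamedMixedBranch` from (T6)/(T7), clause (2)
from D3b′ and (T6), clause (3) from D3c and (T7)'s «a curve stage is not a quadratic transform», the frame from (T0)/(T2), singular members
from D3d. OURS. [folklore] -/
theorem lowRunTamedMixedBranchTwo_of_pieces (hDer : MembersDualDerivationsTwoN) (hB7 : RankFourExitTwo)
    (hC8 : LowSurfaceStepExitsTwo) (hD3a : LowTowerExistsTwo) (hD3b : LowTowerPointStepsIOTwo)
    (hD3c : LowTowerTamingTwo) (hD3d : LowTowerSingularTwo) : LowRunTamedMixedBranchTwo := by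
  intro p hp k K _ _ _ _ _ O A₀ h₀ t hcore hrk R P s hR0 hN hrun hlow
  obtain ⟨L, _iF, _iA, A, Y, h, T, x, g, pt, htower⟩ :=
    hD3a hDer hB7 hC8 p hp k K O A₀ h₀ t hcore hrk R P s hR0 hN hrun hlow
  subst hp
  have hio : pt.Infinite := hD3b k L A Y h T x g pt htower
  obtain ⟨n₀, hn₀⟩ := hD3c k L A Y h T x g pt htower hio
  have hsing := hD3d k L A Y h T x g pt htower
  obtain ⟨_, hAl, htr, _hT1, hT2, _hT3, _hT4, _hT5, hT6, hT7, _hT9⟩ := htower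
  refine ⟨L, _iF, _iA, Y, htr, fun n => ⟨(hT2 n).2.2.2.1, (hT2 n).2.2.2.2.1, (hT2 n).2.2.2.2.2⟩, ⟨?_, ?_, ?_⟩, hsing⟩
  · intro n
    by_cases hn : n ∈ pt
    · exact Or.inl (hT6 n hn).2.2.2
    · exact Or.inr (hT7 n hn).2.1
  · intro n₁
    obtain ⟨n, hn, hlt⟩ := hio.exists_gt n₁
    exact ⟨n, hlt.le, (hT6 n hn).2.2.2⟩
  · refine ⟨n₀, fun n hn hQT => ?_⟩
    by_cases hpt : n ∈ pt
    · exact hn₀ n hn hpt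
    · exact absurd hQT (hT7 n hpt).2.2

/-- **§σ2.24 LOW kernel, all pieces named** (PROVED): `LowOrderTailConclTwoN` from `step`, the LOW inputs, D3a/D3b′/D3c/D3d and res-type-026's
reduction `NoEternalTamedMixedBranch` (in r29+: `tamedMixedBranchReduction_holds hLV`). OURS. [folklore] -/
theorem lowOrderTailConclTwoN_of_pieces
    (step : ∀ p : ℕ, p = 2 →
      ∀ (k K : Type) [Field k] [CharP k p] [PerfectField k] [Field K] [Algebra k K]
      (O : ValuationSubring K) (A₀ : Subalgebra k K) (h₀ : A₀.toSubring ≤ O.toSubring) (t : K),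
      CoreDatum p 4 k K O A₀ h₀ t →
      ∀ (R : ℕ → Subring K) (P : (i : ℕ) → Ideal (R i)) (s : ℕ → K),
        R 0 = locAtCentre A₀.toSubring O → IsSteeredRun O R P t p s →
        ∀ i, ¬ IsHighOrderAt R s p i → ¬ IsHighOrderAt R s p (i + 1))
    (hDer : MembersDualDerivationsTwoN) (hB7 : RankFourExitTwo) (hC8 : LowSurfaceStepExitsTwo)
    (hD3a : LowTowerExistsTwo) (hD3b : LowTowerPointStepsIOTwo) (hD3c : LowTowerTamingTwo) (hD3d : LowTowerSingularTwo)
    (hNE : NoEternalTamedMixedBranch) : LowOrderTailConclTwoN :=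
  lowOrderTailConclTwoN_of_tamedBranch step
    (lowRunTamedMixedBranchTwo_of_pieces hDer hB7 hC8 hD3a hD3b hD3c hD3d) hNE

/-- **D3 modulo C8 and its four tower pieces** (r31: `hDer` := pv-007's `membersDualDerivationsTwoN_holds`, `hB7` := stub-3's
`rankFourExitTwo_holds`, both leaves of record). Pure logic. OURS. [folklore] -/
theorem lowRunTamedMixedBranchTwo_of_pieces' (hC8 : LowSurfaceStepExitsTwo) (hD3a : LowTowerExistsTwo)
    (hD3b : LowTowerPointStepsIOTwo) (hD3c : LowTowerTamingTwo) (hD3d : LowTowerSingularTwo) : LowRunTamedMixedBranchTwo :=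
  lowRunTamedMixedBranchTwo_of_pieces membersDualDerivationsTwoN_holds rankFourExitTwo_holds hC8 hD3a hD3b hD3c hD3d

/-- **T-i · `FinitelyHitThreadTwoN` HOLDS** (adoption leaf over res-D-pv-011 AS stub-7's Theses-free
`ThreadChain.exists_not_noEternalChain_of_finitelyHit` (…Theorems.FrobeniusClosingSteerThreadFinitelyHit, over Ĝ p515983) +
`ThreadChain.noEternalChain_zero` (…ThreadWander) + res-type-096's `TowerHeight.height_le_height_comap_of_tower` (p516898); CoreDatum plumbing
as in `geoDictFin_holds`). OURS. -/
theorem finitelyHitThreadTwoN_holds : FinitelyHitThreadTwoN := by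
  intro p hp2 k K _ _ _ _ _ O A₀ h₀ t core _ R P s hR0 _ hrun J hJ hJA hfin
  subst hp2
  haveI : Fact (Nat.Prime 2) := ⟨Nat.prime_two⟩
  haveI : CharP K 2 := charP_of_injective_algebraMap (algebraMap k K).injective 2
  obtain ⟨hfg, htp, hfr, hreg, -, hzd, -, -, -, -, -, -, htr, -⟩ := core
  have hmono : Monotone R := hrun.monotone
  obtain ⟨-, hstep⟩ := hrun
  have hsp : ∀ i, s i ^ 2 ∈ R i := fun i => by
    obtain ⟨_, hs, -⟩ := hstep i
    exact hs
  have hbl : ∀ i, IsLocalBlowupAlong O (R i) (P i) (R (i + 1)) := fun i => by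
    obtain ⟨_, _, -, hbl, -⟩ := hstep i
    exact hbl
  have h0 : IsRegularLocalRing (R 0) := by
    rw [hR0]
    exact (Literature.AlgebraicGeometry.Resolution.isRegularLocalRing_locAtCentre_iff h₀).mpr hreg
  have hregR : ∀ i, IsRegularLocalRing (R i) := fun i =>
    _root_.Summit.ResolutionOfSingularities.ResolutionOfSingularities.Theorems.SwitchingDichotomy.SteeredMembersRegular.isRegularLocalRing_steps (O := O) R P i h0 (fun j _ => by
      obtain ⟨hloc, hs, hσ, hblj, -⟩ := hstep j
      refine ⟨hloc, ?_, hblj⟩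
      rcases hσ with hperm | ⟨hP, -, -⟩
      · exact Or.inl hperm.2.2.1
      · exact Or.inr hP) i le_rfl
  have hdim : ∀ i, ringKrullDim (R i) = (4 : ℕ) := fun i =>
    _root_.Summit.ResolutionOfSingularities.ResolutionOfSingularities.Theorems.SwitchingDichotomy.TailCodim.ringKrullDim_member_eq
      k K O A₀ h₀ t two_pos hfg htp hfr hzd htr R i hR0 fun j _ => (hbl j).isLocalBlowup
  have hheight : ∀ (i m : ℕ) (hle : R i ≤ R m) (Q : Ideal (R m)) [Q.IsPrime],
      Q.height ≤ (Q.comap (Subring.inclusion hle)).height := by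
    intro i m hle Q _
    by_cases him : i ≤ m
    · exact _root_.Summit.ResolutionOfSingularities.ResolutionOfSingularities.Theorems.SwitchingDichotomy.TowerHeight.height_le_height_comap_of_tower
        O A₀ h₀ hfg t 2 two_pos htp hfr R hR0 (fun j => (hbl j).isLocalBlowup) him hle Q
    · have e : R i = R m := le_antisymm hle (hmono (le_of_not_ge him))
      have key : ∀ (A B : Subring K) (_ : A = B) (h : A ≤ B) (Q : Ideal B) [Q.IsPrime],
          Q.height ≤ (Q.comap (Subring.inclusion h)).height := by
        intro A B e h Q _
        subst e
        have hQ : Q.comap (Subring.inclusion h) = Q := by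
          ext y
          rw [Ideal.mem_comap]
          rfl
        rw [hQ]
      exact key _ _ e hle Q
  have hvis : ∀ i, (∃ _ : IsLocalRing (R i), P i ≠ maximalIdeal (R i)) →
      (P i).IsPrime ∧ (∃ g : R i, (⟨s i ^ 2, hsp i⟩ : R i) - g ^ 2 ∈ P i ^ 2) ∧
      (∀ (Q : Ideal (R i)) [Q.IsPrime], Q < P i →
        IsRegularLocalRing (AdjoinRoot ((Polynomial.X : Polynomial (Localization.AtPrime Q)) ^ 2 -
          Polynomial.C (algebraMap (R i) (Localization.AtPrime Q) ⟨s i ^ 2, hsp i⟩)))) := by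
    intro i ⟨_, hne⟩
    obtain ⟨hloc, hs, hσ, -, -⟩ := hstep i
    have hperm : IsPermissibleCentre (R i) 2 ⟨s i ^ 2, hsp i⟩ (P i) := by
      rcases hσ with hperm | ⟨hP, -, -⟩
      · exact hperm
      · exact absurd hP hne
    obtain ⟨_, -, hmc, -⟩ := hperm.2.1
    refine ⟨hperm.2.1.1, hperm.2.2.2, fun Q hQp hQ => ?_⟩
    by_contra hnr
    exact hQ.ne (hmc Q hnr hQ.le)
  obtain ⟨c, hcn, -, hK⟩ :=
    _root_.Summit.ResolutionOfSingularities.ResolutionOfSingularities.Theorems.SwitchingDichotomy.ThreadChain.exists_not_noEternalChain_of_finitelyHit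
      2 O A₀ h₀ hfg R P s 4 hR0 hbl (fun i => by obtain ⟨_, _, -, -, hst⟩ := hstep i; exact hst) hsp hregR hdim
      hheight hvis (IsPosStep R P) (fun _ => Iff.rfl) (IsAncestorStep R P) (fun _ _ => Iff.rfl) J hJ hJA hfin
  rcases Nat.eq_zero_or_pos c with rfl | hc1
  · exact absurd (_root_.Summit.ResolutionOfSingularities.ResolutionOfSingularities.Theorems.SwitchingDichotomy.ThreadChain.noEternalChain_zero 2) hK
  · exact ⟨c, hc1, by omega, hK⟩

/-- **THREAD · `ThreadWanderTwoN` modulo Lipman + CP** — second, independent route (res-D-pv-011 AS stub-7's Θ3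
`ThreadChain.births_or_branching_of_thread`, …Theorems.FrobeniusClosingSteerThreadWander: the descent runs INSIDE the thread; pv-003's
§σ2.25 runs it in the skeleton). K(3) currency here: `CossartPiltant2019HironakaLUIsolatedBranch` (r24 `…_three_of_CP`); for the T-line's
printed shape replace `hCP` by `hCP'` and `noEternalIsolatedRadicandChain_three_of_CP hCP` by `…_three_of_CP' hCP'` (defined after
`end SteeredTwo`). The height brick is res-type-096's `TowerHeight.height_le_height_comap_of_tower` (p516898). OURS. -/
theorem threadWanderTwoN_of_debts
    (hL : Literature.AlgebraicGeometry.Resolution.Lipman1978NoEternalNormalBranch.{0})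
    (hCP : Literature.AlgebraicGeometry.Resolution.CossartPiltant2019HironakaLUIsolatedBranch.{0}) :
    ThreadWanderTwoN := by
  intro p hp2 k K _ _ _ _ _ O A₀ h₀ t core _ R P s hR0 _ hrun _ _ hthread
  subst hp2
  haveI : Fact (Nat.Prime 2) := ⟨Nat.prime_two⟩
  haveI : CharP K 2 := charP_of_injective_algebraMap (algebraMap k K).injective 2
  obtain ⟨hfg, htp, hfr, hreg, -, hzd, -, -, -, -, -, -, htr, -⟩ := core
  have hmono : Monotone R := hrun.monotone
  obtain ⟨-, hstep⟩ := hrun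
  obtain ⟨J, hJ, hJA⟩ := hthread
  have hsp : ∀ i, s i ^ 2 ∈ R i := fun i => by
    obtain ⟨_, hs, -⟩ := hstep i
    exact hs
  have hbl : ∀ i, IsLocalBlowupAlong O (R i) (P i) (R (i + 1)) := fun i => by
    obtain ⟨_, _, -, hbl, -⟩ := hstep i
    exact hbl
  have h0 : IsRegularLocalRing (R 0) := by
    rw [hR0]
    exact (Literature.AlgebraicGeometry.Resolution.isRegularLocalRing_locAtCentre_iff h₀).mpr hreg
  have hregR : ∀ i, IsRegularLocalRing (R i) := fun i =>
    _root_.Summit.ResolutionOfSingularities.ResolutionOfSingularities.Theorems.SwitchingDichotomy.SteeredMembersRegular.isRegularLocalRing_steps (O := O) R P i h0 (fun j _ => by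
      obtain ⟨hloc, hs, hσ, hblj, -⟩ := hstep j
      refine ⟨hloc, ?_, hblj⟩
      rcases hσ with hperm | ⟨hP, -, -⟩
      · exact Or.inl hperm.2.2.1
      · exact Or.inr hP) i le_rfl
  have hdim : ∀ i, ringKrullDim (R i) = (4 : ℕ) := fun i =>
    _root_.Summit.ResolutionOfSingularities.ResolutionOfSingularities.Theorems.SwitchingDichotomy.TailCodim.ringKrullDim_member_eq
      k K O A₀ h₀ t two_pos hfg htp hfr hzd htr R i hR0 fun j _ => (hbl j).isLocalBlowup
  have hheight : ∀ (i m : ℕ) (hle : R i ≤ R m) (Q : Ideal (R m)) [Q.IsPrime],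
      Q.height ≤ (Q.comap (Subring.inclusion hle)).height := by
    intro i m hle Q _
    by_cases him : i ≤ m
    · exact _root_.Summit.ResolutionOfSingularities.ResolutionOfSingularities.Theorems.SwitchingDichotomy.TowerHeight.height_le_height_comap_of_tower
        O A₀ h₀ hfg t 2 two_pos htp hfr R hR0 (fun j => (hbl j).isLocalBlowup) him hle Q
    · have e : R i = R m := le_antisymm hle (hmono (le_of_not_ge him))
      have key : ∀ (A B : Subring K) (_ : A = B) (h : A ≤ B) (Q : Ideal B) [Q.IsPrime],
          Q.height ≤ (Q.comap (Subring.inclusion h)).height := by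
        intro A B e h Q _
        subst e
        have hQ : Q.comap (Subring.inclusion h) = Q := by
          ext y
          rw [Ideal.mem_comap]
          rfl
        rw [hQ]
      exact key _ _ e hle Q
  have hvis : ∀ i, (∃ _ : IsLocalRing (R i), P i ≠ maximalIdeal (R i)) →
      (P i).IsPrime ∧ (∃ g : R i, (⟨s i ^ 2, hsp i⟩ : R i) - g ^ 2 ∈ P i ^ 2) ∧
      (∀ (Q : Ideal (R i)) [Q.IsPrime], Q < P i →
        IsRegularLocalRing (AdjoinRoot ((Polynomial.X : Polynomial (Localization.AtPrime Q)) ^ 2 -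
          Polynomial.C (algebraMap (R i) (Localization.AtPrime Q) ⟨s i ^ 2, hsp i⟩)))) := by
    intro i ⟨_, hne⟩
    obtain ⟨hloc, hs, hσ, -, -⟩ := hstep i
    have hperm : IsPermissibleCentre (R i) 2 ⟨s i ^ 2, hsp i⟩ (P i) := by
      rcases hσ with hperm | ⟨hP, -, -⟩
      · exact hperm
      · exact absurd hP hne
    obtain ⟨_, -, hmc, -⟩ := hperm.2.1
    refine ⟨hperm.2.1.1, hperm.2.2.2, fun Q hQp hQ => ?_⟩
    by_contra hnr
    exact hQ.ne (hmc Q hnr hQ.le)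
  have hK : ∀ c, c < 4 → NoEternalIsolatedRadicandChain 2 c := by
    intro c hc
    interval_cases c
    · exact _root_.Summit.ResolutionOfSingularities.ResolutionOfSingularities.Theorems.SwitchingDichotomy.ThreadChain.noEternalChain_zero 2
    · exact noEternalIsolatedRadicandChain_one_holds 2 Nat.prime_two
    · exact noEternalIsolatedRadicandChain_two_of_lipman hL 2 Nat.prime_two
    · exact noEternalIsolatedRadicandChain_three_of_CP hCP 2 Nat.prime_two
  exact _root_.Summit.ResolutionOfSingularities.ResolutionOfSingularities.Theorems.SwitchingDichotomy.ThreadChain.births_or_branching_of_thread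
    2 O A₀ h₀ hfg R P s 4 hR0 hbl (fun i => by obtain ⟨_, _, -, -, hst⟩ := hstep i; exact hst) hsp hregR hdim hheight
    hvis hK (IsPosStep R P) (fun _ => Iff.rfl) (IsAncestorStep R P) (fun _ _ => Iff.rfl) J hJ hJA

/-- **D3b′ `LowTowerPointStepsIOTwo` holds** (adoption leaf over res-D-pv-007 AS stub-5's `LowTowerPointSteps.pt_infinite`: project the
clauses (T1)(T2)(T3)(T5)(T7) of `IsLowTowerTwo`). OURS. [folklore] -/
theorem lowTowerPointStepsIOTwo_holds : LowTowerPointStepsIOTwo := by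
  intro k L _i1 _i2 _i3 _i4 _i5 A Y h T x g pt hT
  obtain ⟨_, hAl, -, hT1, hT2, hT3, -, hT5, -, hT7, -⟩ := hT
  exact _root_.Summit.ResolutionOfSingularities.ResolutionOfSingularities.Theorems.SwitchingDichotomy.LowTowerPointSteps.pt_infinite
    k A h x g pt hAl (fun n => ⟨(hT1 n).1, (hT1 n).2.2.1⟩) (fun n => (hT2 n).1) hT3
    (fun n => ⟨(hT5 n).1, (hT5 n).2.1, (hT5 n).2.2.1, (hT5 n).2.2.2.1⟩) (fun n hn => (hT7 n hn).1)

/-- **D3d leaf** (res-L0-w41-stub-3 g6, p518648 `…SteerLowTowerSingular`): every member of a LOW tower is SINGULAR — clause (T4)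
(order descent `h n − γ² ∈ 𝔪²_{A n}`), (T1) (`A n` regular local, characteristic 2 by the frame), (T3) (hygiene) and the presentation
(T2) `(Y n).toSubring = A n[T n]` feed `LowTower.not_isRegularLocalRing_closure_insert`, transported to the subalgebra `Y n` by
`LowTower.not_isRegularLocalRing_of_toSubring_eq`. OURS. [cite: Matsumura1987, Thm. 14.2] -/
theorem lowTowerSingularTwo_holds : LowTowerSingularTwo := by
  intro k L _ _ _ _ _ A Y h T x g pt htower n
  obtain ⟨hchar, hAl, -, hT1, hT2, hT3, hT4, -⟩ := htower
  haveI := hchar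
  haveI : IsRegularLocalRing (A n).toSubring := (hT1 n).1
  obtain ⟨hh, hTT, hY, -⟩ := hT2 n
  exact Summit.ResolutionOfSingularities.ResolutionOfSingularities.Theorems.SwitchingDichotomy.LowTower.not_isRegularLocalRing_of_toSubring_eq
    (Y n) _ hY
    (Summit.ResolutionOfSingularities.ResolutionOfSingularities.Theorems.SwitchingDichotomy.LowTower.not_isRegularLocalRing_closure_insert
      (A n).toSubring hh hTT (hT4 n hh) (fun u v hv => hT3 n u v u.2 v.2 hv))

/-- **D3 modulo D3a and D3c** (r32: C8 `lowSurfaceStepExitsTwo_holds` (res-type-072), D3b′ `lowTowerPointStepsIOTwo_holds` (res-D-pv-007),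
D3d `lowTowerSingularTwo_holds` (res-L0-w41-stub-3) discharged). Pure logic. OURS. [folklore] -/
theorem lowRunTamedMixedBranchTwo_of_pieces'' (hD3a : LowTowerExistsTwo) (hD3c : LowTowerTamingTwo) :
    LowRunTamedMixedBranchTwo :=
  lowRunTamedMixedBranchTwo_of_pieces' lowSurfaceStepExitsTwo_holds hD3a lowTowerPointStepsIOTwo_holds hD3c
    lowTowerSingularTwo_holds


end SteeredTwo

end Summit.ResolutionOfSingularities.ResolutionOfSingularities.Theorems.SwitchingDichotomy.Words
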